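import Summits.NavierStokesRegularity.NavierStokesRegularity.Theses.AxisymmetricExtremality
import Summits.NavierStokesRegularity.NavierStokesRegularity.Theorems.AxisymmetricExtremalityAxisymmetricKatoGlobalStubSeregin2020TypeIISwirlAtRegularAxisPoints
import Literature.Analysis.FluidPDE.Seregin2020SwirlEquationOffAxis
import HarnessLib

/-!
# Seregin 2020, proof of Thm 2.1, the `Γ ≡ 0` step: the functions `Π = c + s Γ` are in the
# class 𝒱 of Lemma 2.2 and solve the drift–diffusion equation (2.11) off the axis

Helper toward the stub `stub_seregin2020TypeII` of the crux `AxisymmetricKatoGlobal` (= the named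
fact `Literature.Analysis.FluidPDE.Seregin2020_axisymmetricSingularPoint_typeII`, G. Seregin,
Anal. Math. Phys. 10 (2020) Paper 46 = arXiv:2006.04140, Thm 2.1). The "standard arguments"
deducing `Γ ≡ 0` from Lemma 2.2 (arXiv p. 8) apply the lemma to `Π = Γ₀ ∓ Γ`, `Γ = ϱ u_φ` the
swirl of the ancient limit, `Γ₀ = sup |Γ|`. For a field `V` in the Seregin–Zajaczkowski class
`IsSmoothAxisymmetricSolutionOn` on every rotation invariant open subset of `Q(a) ∖ Σ`, `a > 0`,
`Σ ⊆ {x' = 0}` closed (the global representative of `exists_smooth_repr_off_backwardSingular`),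
this file verifies the regularity clauses of the class 𝒱 of Lemma 2.2 for `Π = c + s Γ`,
`Γ = swirl (V t) x = x₀V₁ - x₁V₀`, in the tree's classical rendering: continuity of `Π`, `∇Π`,
`∂ₑ∂ₑΠ` on `{t < 0} ∖ Σ`, smooth slices, and — off the axis — the classical time derivative, its
continuity, and the swirl equation (2.11) `∂ₜΠ + (V + 2x'/|x'|²)·∇Π - ΔΠ = 0` (the tree's (2.2),
`Seregin2020.hasDerivAt_swirl_offAxis`, on the off-axis regions `]-a², 0[ × (B(0,a) ∖ {x' = 0})`).

## References

* G. Seregin, Anal. Math. Phys. 10 (2020), Paper 46 = arXiv:2006.04140, proof of Thm. 2.1,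
  (2.11), the class 𝒱 and Lemma 2.2 (arXiv p. 8). [Seregin2020]
-/

-- the problem directory repeats the summit name (D-0017); core's `dupNamespace` linter fires
set_option linter.dupNamespace false

noncomputable section

open MeasureTheory Set Function Filter Topology TopologicalSpace Metric
open scoped NNReal ENNReal Laplacian

namespace Summit.NavierStokesRegularity.NavierStokesRegularity.Theorems.AxisymmetricKatoGlobal.EulerScaling

open Literature.Analysis.FluidPDE Literature.Analysis.FluidPDE.SereginZajaczkowski2007
  Literature.Analysis.FluidPDE.Seregin2020

section Class

variable {V : ℝ → EuclideanSpace ℝ (Fin 3) → EuclideanSpace ℝ (Fin 3)}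
  {P : ℝ → EuclideanSpace ℝ (Fin 3) → ℝ} {A : Set (ℝ × EuclideanSpace ℝ (Fin 3))}

/-! ### Geometry: rotation invariance, exhaustion by the cylinders `Q(n)` -/

/-- The cylinders `Q(a)` about the origin are invariant under `(t, x) ↦ (t, R_θ x)`. [folklore] -/
theorem rot_mem_parabolicCylinder_zero (θ : ℝ) {a : ℝ} {z : ℝ × EuclideanSpace ℝ (Fin 3)}
    (hz : z ∈ parabolicCylinder a (0 : ℝ × EuclideanSpace ℝ (Fin 3))) :
    ((z.1, rotZ θ z.2) : ℝ × EuclideanSpace ℝ (Fin 3)) ∈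
      parabolicCylinder a (0 : ℝ × EuclideanSpace ℝ (Fin 3)) := by
  rw [mem_parabolicCylinder] at hz ⊢
  simpa [norm_rotZ] using hz

/-- Removing a subset of the axis from a rotation invariant set keeps it rotation invariant (the
rotations fix the axis pointwise). [folklore] -/
theorem rot_mem_diff_of_subset_axis {A B : Set (ℝ × EuclideanSpace ℝ (Fin 3))}
    (hA : ∀ z ∈ A, cylRadius z.2 = 0)
    (hB : ∀ θ : ℝ, ∀ z ∈ B, ((z.1, rotZ θ z.2) : ℝ × EuclideanSpace ℝ (Fin 3)) ∈ B) (θ : ℝ)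
    {z : ℝ × EuclideanSpace ℝ (Fin 3)} (hz : z ∈ B \ A) :
    ((z.1, rotZ θ z.2) : ℝ × EuclideanSpace ℝ (Fin 3)) ∈ B \ A := by
  refine ⟨hB θ z hz.1, fun hmem => hz.2 ?_⟩
  have h0 : cylRadius (rotZ θ z.2) = 0 := hA _ hmem
  rw [cylRadius_rotZ] at h0
  rwa [rotZ_eq_self_of_cylRadius h0 θ, Prod.mk.eta] at hmem

/-- A point `(t, x)`, `t < 0`, lies in the cylinder `Q(⌈‖x‖ + |t|⌉₊ + 1)` about the origin.
[folklore] -/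
theorem mem_parabolicCylinder_natCeil {z : ℝ × EuclideanSpace ℝ (Fin 3)} (hz : z.1 < 0) :
    z ∈ parabolicCylinder ((⌈‖z.2‖ + |z.1|⌉₊ : ℝ) + 1) (0 : ℝ × EuclideanSpace ℝ (Fin 3)) := by
  have hc : ‖z.2‖ + |z.1| ≤ (⌈‖z.2‖ + |z.1|⌉₊ : ℝ) := Nat.le_ceil _
  have ht : |z.1| = -z.1 := abs_of_neg hz
  have hn : (0 : ℝ) ≤ (⌈‖z.2‖ + |z.1|⌉₊ : ℝ) := Nat.cast_nonneg _
  have hx : 0 ≤ ‖z.2‖ := norm_nonneg _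
  rw [mem_parabolicCylinder]
  simp only [Prod.fst_zero, Prod.snd_zero, dist_zero_right, zero_sub]
  refine ⟨⟨?_, hz⟩, by linarith⟩
  nlinarith

/-! ### The off-axis product regions `]-a², 0[ × (B(0,a) ∖ {x' = 0})` -/

/-- The off-axis part of the ball is open. [folklore] -/
theorem isOpen_ball_inter_cylRadius_ne (a : ℝ) :
    IsOpen (ball (0 : EuclideanSpace ℝ (Fin 3)) a ∩ {y | cylRadius y ≠ 0}) :=
  isOpen_ball.inter (isOpen_compl_singleton.preimage continuous_cylRadius)

/-- The off-axis product region `]-a², 0[ × (B(0,a) ∖ {x' = 0})` lies in `Q(a) ∖ Σ` for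
`Σ ⊆ {x' = 0}`. [folklore] -/
theorem offAxisRegion_subset (haxis : ∀ z ∈ A, cylRadius z.2 = 0) (a : ℝ) :
    Ioo (-a ^ 2) 0 ×ˢ (ball (0 : EuclideanSpace ℝ (Fin 3)) a ∩ {y | cylRadius y ≠ 0}) ⊆
      parabolicCylinder a (0 : ℝ × EuclideanSpace ℝ (Fin 3)) \ A := by
  rintro z ⟨ht, hx, hρ⟩
  refine ⟨?_, fun hzA => hρ (haxis z hzA)⟩
  rw [mem_parabolicCylinder]
  simp only [Prod.fst_zero, Prod.snd_zero, zero_sub]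
  exact ⟨ht, mem_ball.1 hx⟩

/-- The off-axis product region is rotation invariant. [folklore] -/
theorem rot_mem_offAxisRegion (a θ : ℝ) {z : ℝ × EuclideanSpace ℝ (Fin 3)}
    (hz : z ∈ Ioo (-a ^ 2) 0 ×ˢ (ball (0 : EuclideanSpace ℝ (Fin 3)) a ∩ {y | cylRadius y ≠ 0})) :
    ((z.1, rotZ θ z.2) : ℝ × EuclideanSpace ℝ (Fin 3)) ∈
      Ioo (-a ^ 2) 0 ×ˢ (ball (0 : EuclideanSpace ℝ (Fin 3)) a ∩ {y | cylRadius y ≠ 0}) := by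
  obtain ⟨ht, hx, hρ⟩ := hz
  refine ⟨ht, ?_, ?_⟩
  · simpa [norm_rotZ] using hx
  · simpa [cylRadius_rotZ] using hρ

/-- A point `(t, x)`, `t < 0`, `x' ≠ 0`, lies in the off-axis product region of radius
`⌈‖x‖ + |t|⌉₊ + 1`. [folklore] -/
theorem mem_offAxisRegion_natCeil {z : ℝ × EuclideanSpace ℝ (Fin 3)} (hz : z.1 < 0)
    (hρ : cylRadius z.2 ≠ 0) :
    z ∈ Ioo (-(((⌈‖z.2‖ + |z.1|⌉₊ : ℝ) + 1) ^ 2)) 0 ×ˢ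
      (ball (0 : EuclideanSpace ℝ (Fin 3)) ((⌈‖z.2‖ + |z.1|⌉₊ : ℝ) + 1) ∩ {y | cylRadius y ≠ 0}) := by
  have hc : ‖z.2‖ + |z.1| ≤ (⌈‖z.2‖ + |z.1|⌉₊ : ℝ) := Nat.le_ceil _
  have ht : |z.1| = -z.1 := abs_of_neg hz
  have hn : (0 : ℝ) ≤ (⌈‖z.2‖ + |z.1|⌉₊ : ℝ) := Nat.cast_nonneg _
  have hx : 0 ≤ ‖z.2‖ := norm_nonneg _
  refine ⟨⟨by nlinarith, hz⟩, ?_, hρ⟩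
  rw [mem_ball, dist_zero_right]
  linarith

/-- **The class on the off-axis product regions.** If `(V, P)` is in the Seregin–Zajaczkowski
class on every rotation invariant open subset of `Q(a) ∖ Σ`, `a > 0`, `Σ ⊆ {x' = 0}`, then it is
in the class on `]-a², 0[ × (B(0,a) ∖ {x' = 0})`. [folklore] -/
theorem isSmoothAxisymmetricSolutionOn_offAxisRegion (haxis : ∀ z ∈ A, cylRadius z.2 = 0)
    (hVcl : ∀ a : ℝ, 0 < a → ∀ O : Opens (ℝ × EuclideanSpace ℝ (Fin 3)),
      (O : Set (ℝ × EuclideanSpace ℝ (Fin 3))) ⊆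
        parabolicCylinder a (0 : ℝ × EuclideanSpace ℝ (Fin 3)) \ A →
      (∀ θ : ℝ, ∀ z ∈ (O : Set (ℝ × EuclideanSpace ℝ (Fin 3))),
        ((z.1, rotZ θ z.2) : ℝ × EuclideanSpace ℝ (Fin 3)) ∈
          (O : Set (ℝ × EuclideanSpace ℝ (Fin 3)))) →
      IsSmoothAxisymmetricSolutionOn O V P)
    {a : ℝ} (ha : 0 < a) :
    IsSmoothAxisymmetricSolutionOn
      (⟨Ioo (-a ^ 2) 0 ×ˢ (ball (0 : EuclideanSpace ℝ (Fin 3)) a ∩ {y | cylRadius y ≠ 0}),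
        isOpen_Ioo.prod (isOpen_ball_inter_cylRadius_ne a)⟩ : Opens (ℝ × EuclideanSpace ℝ (Fin 3)))
      V P :=
  hVcl a ha _ (offAxisRegion_subset haxis a) (fun θ _ hz => rot_mem_offAxisRegion a θ hz)

/-! ### The swirl `Γ = swirl V` off the axis: the classical time derivative and (2.11) -/

/-- **The swirl equation (2.11) for the representative, at every off-axis point of `{t < 0}`.**
With `Γ(t, x) = swirl (V t) x`: `t ↦ Γ(t, x)` has at `t < 0`, `x' ≠ 0`, the classical derivative
`ΔΓ - DΓ[V] - (2/ϱ)∂_ϱΓ`, i.e. `∂ₜΓ + (V + 2x'/|x'|²)·∇Γ - ΔΓ = 0` (the tree's (2.2),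
`Seregin2020.hasDerivAt_swirl_offAxis`, on the off-axis product region through the point).
[cite: Seregin2020, proof of Thm 2.1, (2.11)] -/
theorem hasDerivAt_swirl_repr (haxis : ∀ z ∈ A, cylRadius z.2 = 0)
    (hVcl : ∀ a : ℝ, 0 < a → ∀ O : Opens (ℝ × EuclideanSpace ℝ (Fin 3)),
      (O : Set (ℝ × EuclideanSpace ℝ (Fin 3))) ⊆
        parabolicCylinder a (0 : ℝ × EuclideanSpace ℝ (Fin 3)) \ A →
      (∀ θ : ℝ, ∀ z ∈ (O : Set (ℝ × EuclideanSpace ℝ (Fin 3))),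
        ((z.1, rotZ θ z.2) : ℝ × EuclideanSpace ℝ (Fin 3)) ∈
          (O : Set (ℝ × EuclideanSpace ℝ (Fin 3)))) →
      IsSmoothAxisymmetricSolutionOn O V P)
    {z : ℝ × EuclideanSpace ℝ (Fin 3)} (hz : z.1 < 0) (hρ : cylRadius z.2 ≠ 0) :
    HasDerivAt (fun r => swirl (V r) z.2)
      ((Δ (swirl (V z.1))) z.2 - fderiv ℝ (swirl (V z.1)) z.2 (V z.1 z.2) -
        2 / cylRadius z.2 * partialDeriv (eR z.2) (swirl (V z.1)) z.2) z.1 := by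
  have hapos : (0 : ℝ) < (⌈‖z.2‖ + |z.1|⌉₊ : ℝ) + 1 := by positivity
  obtain ⟨ht, hx⟩ := mem_offAxisRegion_natCeil hz hρ
  have hV := isSmoothAxisymmetricSolutionOn_offAxisRegion haxis hVcl hapos
  exact Seregin2020.hasDerivAt_swirl_offAxis (isOpen_ball_inter_cylRadius_ne _) rfl
    (fun θ w hw => by exact rot_mem_offAxisRegion _ θ hw) (fun w hw => by exact hw.2.2) hV hx ht

/-- The right-hand side `ΔΓ - DΓ[V] - (2/ϱ)∂_ϱΓ` of (2.11) is continuous on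
`{t < 0} × {x' ≠ 0}` (`Seregin2020.continuousOn_swirlOperator_offAxis` on the off-axis product
regions, which are open and cover). [cite: Seregin2020, proof of Thm 2.1, (2.11)] -/
theorem continuousOn_swirlOperator_repr (haxis : ∀ z ∈ A, cylRadius z.2 = 0)
    (hVcl : ∀ a : ℝ, 0 < a → ∀ O : Opens (ℝ × EuclideanSpace ℝ (Fin 3)),
      (O : Set (ℝ × EuclideanSpace ℝ (Fin 3))) ⊆
        parabolicCylinder a (0 : ℝ × EuclideanSpace ℝ (Fin 3)) \ A →
      (∀ θ : ℝ, ∀ z ∈ (O : Set (ℝ × EuclideanSpace ℝ (Fin 3))),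
        ((z.1, rotZ θ z.2) : ℝ × EuclideanSpace ℝ (Fin 3)) ∈
          (O : Set (ℝ × EuclideanSpace ℝ (Fin 3)))) →
      IsSmoothAxisymmetricSolutionOn O V P) :
    ContinuousOn (fun z : ℝ × EuclideanSpace ℝ (Fin 3) =>
      (Δ (swirl (V z.1))) z.2 - fderiv ℝ (swirl (V z.1)) z.2 (V z.1 z.2) -
        2 / cylRadius z.2 * partialDeriv (eR z.2) (swirl (V z.1)) z.2)
      {z | z.1 < 0 ∧ cylRadius z.2 ≠ 0} := by
  refine continuousOn_of_forall_continuousAt fun z hz => ?_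
  have hapos : (0 : ℝ) < (⌈‖z.2‖ + |z.1|⌉₊ : ℝ) + 1 := by positivity
  have hmem := mem_offAxisRegion_natCeil hz.1 hz.2
  have hV := isSmoothAxisymmetricSolutionOn_offAxisRegion haxis hVcl hapos
  have hc := Seregin2020.continuousOn_swirlOperator_offAxis hV (fun w hw => by exact hw.2.2)
  exact hc.continuousAt ((isOpen_Ioo.prod (isOpen_ball_inter_cylRadius_ne _)).mem_nhds hmem)

/-! ### The velocity representative off the axis -/

/-- `V` is continuous, with `C^∞` slices and continuous spatial gradient, on
`{t < 0} × {x' ≠ 0}`. [folklore] -/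
theorem velocity_repr_offAxis (haxis : ∀ z ∈ A, cylRadius z.2 = 0)
    (hVcl : ∀ a : ℝ, 0 < a → ∀ O : Opens (ℝ × EuclideanSpace ℝ (Fin 3)),
      (O : Set (ℝ × EuclideanSpace ℝ (Fin 3))) ⊆
        parabolicCylinder a (0 : ℝ × EuclideanSpace ℝ (Fin 3)) \ A →
      (∀ θ : ℝ, ∀ z ∈ (O : Set (ℝ × EuclideanSpace ℝ (Fin 3))),
        ((z.1, rotZ θ z.2) : ℝ × EuclideanSpace ℝ (Fin 3)) ∈
          (O : Set (ℝ × EuclideanSpace ℝ (Fin 3)))) →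
      IsSmoothAxisymmetricSolutionOn O V P) :
    ContinuousOn (uncurry V) {z : ℝ × EuclideanSpace ℝ (Fin 3) | z.1 < 0 ∧ cylRadius z.2 ≠ 0} ∧
      (∀ z : ℝ × EuclideanSpace ℝ (Fin 3), z.1 < 0 → cylRadius z.2 ≠ 0 →
        ContDiffAt ℝ (⊤ : ℕ∞) (V z.1) z.2) ∧
      ContinuousOn (fun z : ℝ × EuclideanSpace ℝ (Fin 3) => fderiv ℝ (V z.1) z.2)
        {z | z.1 < 0 ∧ cylRadius z.2 ≠ 0} := by
  have key : ∀ z : ℝ × EuclideanSpace ℝ (Fin 3), z.1 < 0 → cylRadius z.2 ≠ 0 →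
      ∃ O : Opens (ℝ × EuclideanSpace ℝ (Fin 3)), z ∈ (O : Set (ℝ × EuclideanSpace ℝ (Fin 3))) ∧
        IsSmoothAxisymmetricSolutionOn O V P := by
    intro z hz hρ
    have hapos : (0 : ℝ) < (⌈‖z.2‖ + |z.1|⌉₊ : ℝ) + 1 := by positivity
    exact ⟨_, mem_offAxisRegion_natCeil hz hρ,
      isSmoothAxisymmetricSolutionOn_offAxisRegion haxis hVcl hapos⟩
  refine ⟨?_, ?_, ?_⟩
  · refine continuousOn_of_forall_continuousAt fun z hz => ?_
    obtain ⟨O, hzO, hV⟩ := key z hz.1 hz.2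
    exact hV.continuousOn_velocity.continuousAt (O.isOpen.mem_nhds hzO)
  · intro z hz hρ
    obtain ⟨O, hzO, hV⟩ := key z hz hρ
    exact hV.contDiffAt z hzO
  · refine continuousOn_of_forall_continuousAt fun z hz => ?_
    obtain ⟨O, hzO, hV⟩ := key z hz.1 hz.2
    exact hV.continuousOn_fderiv.continuousAt (O.isOpen.mem_nhds hzO)

/-! ### The class near every point of `{t < 0} ∖ Σ` -/

/-- **Every point of `{t < 0} ∖ Σ` has an open neighbourhood on which `(V, P)` is in the class**
(namely `Q(a) ∖ Σ` for `a = ⌈‖x‖ + |t|⌉₊ + 1`, open since `Σ` is closed, rotation invariant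
since `Σ ⊆ {x' = 0}`). [folklore] -/
theorem exists_mem_isSmoothAxisymmetricSolutionOn (hcl : IsClosed A)
    (haxis : ∀ z ∈ A, cylRadius z.2 = 0)
    (hVcl : ∀ a : ℝ, 0 < a → ∀ O : Opens (ℝ × EuclideanSpace ℝ (Fin 3)),
      (O : Set (ℝ × EuclideanSpace ℝ (Fin 3))) ⊆
        parabolicCylinder a (0 : ℝ × EuclideanSpace ℝ (Fin 3)) \ A →
      (∀ θ : ℝ, ∀ z ∈ (O : Set (ℝ × EuclideanSpace ℝ (Fin 3))),
        ((z.1, rotZ θ z.2) : ℝ × EuclideanSpace ℝ (Fin 3)) ∈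
          (O : Set (ℝ × EuclideanSpace ℝ (Fin 3)))) →
      IsSmoothAxisymmetricSolutionOn O V P)
    {z : ℝ × EuclideanSpace ℝ (Fin 3)} (hz : z.1 < 0) (hzA : z ∉ A) :
    ∃ O : Opens (ℝ × EuclideanSpace ℝ (Fin 3)),
      z ∈ (O : Set (ℝ × EuclideanSpace ℝ (Fin 3))) ∧
      (O : Set (ℝ × EuclideanSpace ℝ (Fin 3))) ⊆ {z | z.1 < 0} \ A ∧
      IsSmoothAxisymmetricSolutionOn O V P := by
  have hapos : (0 : ℝ) < (⌈‖z.2‖ + |z.1|⌉₊ : ℝ) + 1 := by positivity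
  refine ⟨⟨parabolicCylinder ((⌈‖z.2‖ + |z.1|⌉₊ : ℝ) + 1) (0 : ℝ × EuclideanSpace ℝ (Fin 3)) \ A,
    (isOpen_parabolicCylinder _ _).sdiff hcl⟩, ⟨mem_parabolicCylinder_natCeil hz, hzA⟩, ?_, ?_⟩
  · rintro w ⟨hw, hwA⟩
    refine ⟨?_, hwA⟩
    have h := (mem_parabolicCylinder.1 hw).1.2
    simpa using h
  · exact hVcl _ hapos _ subset_rfl fun θ w hw => by
      exact rot_mem_diff_of_subset_axis haxis (fun θ w hw => rot_mem_parabolicCylinder_zero θ hw) θ hw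

/-- The slice of an open set of `ℝ × ℝ³` through a point is a neighbourhood of the space
component. [folklore] -/
theorem eventually_mem_slice {O : Set (ℝ × EuclideanSpace ℝ (Fin 3))} (hO : IsOpen O)
    {w : ℝ × EuclideanSpace ℝ (Fin 3)} (hw : w ∈ O) :
    ∀ᶠ y in 𝓝 w.2, ((w.1, y) : ℝ × EuclideanSpace ℝ (Fin 3)) ∈ O := by
  have hmk : Continuous fun y : EuclideanSpace ℝ (Fin 3) => ((w.1, y) : ℝ × EuclideanSpace ℝ (Fin 3)) :=
    continuous_const.prodMk continuous_id
  exact (hO.preimage hmk).mem_nhds (by simpa using hw)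

/-! ### The functions `Π = c + s Γ`, `Γ = swirl V`: the regularity clauses of the class 𝒱 -/

/-- **`Π = c + s Γ` is continuous on `{t < 0} ∖ Σ`, its slices are `C^∞` there, and `∇Π`,
`∂ₑ∂ₑΠ` are continuous on `{t < 0} ∖ Σ` in space–time** (the clauses (i) of the class 𝒱 of
Lemma 2.2 for `Π`, in the tree's rendering; from the class of `V` near every such point:
`∇Π = s ∇Γ`, `∂ₑ∂ₑΠ = s ∂ₑ∂ₑΓ`, and the tree's continuity of `Γ, ∂ₑΓ, ∂ₑ∂ₑΓ` for the class).
[cite: Seregin2020, proof of Thm 2.1, the class 𝒱 (i) (arXiv p. 8)] -/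
theorem affSwirl_classV_spatial (hcl : IsClosed A) (haxis : ∀ z ∈ A, cylRadius z.2 = 0)
    (hVcl : ∀ a : ℝ, 0 < a → ∀ O : Opens (ℝ × EuclideanSpace ℝ (Fin 3)),
      (O : Set (ℝ × EuclideanSpace ℝ (Fin 3))) ⊆
        parabolicCylinder a (0 : ℝ × EuclideanSpace ℝ (Fin 3)) \ A →
      (∀ θ : ℝ, ∀ z ∈ (O : Set (ℝ × EuclideanSpace ℝ (Fin 3))),
        ((z.1, rotZ θ z.2) : ℝ × EuclideanSpace ℝ (Fin 3)) ∈
          (O : Set (ℝ × EuclideanSpace ℝ (Fin 3)))) →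
      IsSmoothAxisymmetricSolutionOn O V P) (c s : ℝ) :
    ContinuousOn (uncurry fun t y => c + s * swirl (V t) y)
        ({z : ℝ × EuclideanSpace ℝ (Fin 3) | z.1 < 0} \ A) ∧
      (∀ z : ℝ × EuclideanSpace ℝ (Fin 3), z.1 < 0 → z ∉ A →
        ContDiffAt ℝ (⊤ : ℕ∞) (fun y => c + s * swirl (V z.1) y) z.2) ∧
      ContinuousOn (fun z : ℝ × EuclideanSpace ℝ (Fin 3) =>
          fderiv ℝ (fun y => c + s * swirl (V z.1) y) z.2)
        ({z : ℝ × EuclideanSpace ℝ (Fin 3) | z.1 < 0} \ A) ∧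
      ∀ e : EuclideanSpace ℝ (Fin 3), ContinuousOn (fun z : ℝ × EuclideanSpace ℝ (Fin 3) =>
          fderiv ℝ (fun y => fderiv ℝ (fun y => c + s * swirl (V z.1) y) y e) z.2 e)
        ({z : ℝ × EuclideanSpace ℝ (Fin 3) | z.1 < 0} \ A) := by
  have key := fun (z : ℝ × EuclideanSpace ℝ (Fin 3)) (hz : z ∈ {z : ℝ × EuclideanSpace ℝ (Fin 3) | z.1 < 0} \ A) =>
    exists_mem_isSmoothAxisymmetricSolutionOn hcl haxis hVcl hz.1 hz.2
  -- `∇Π = s ∇Γ` at the points of a class region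
  have hgrad : ∀ {O : Opens (ℝ × EuclideanSpace ℝ (Fin 3))}, IsSmoothAxisymmetricSolutionOn O V P →
      ∀ w ∈ (O : Set (ℝ × EuclideanSpace ℝ (Fin 3))),
        fderiv ℝ (fun y => c + s * swirl (V w.1) y) w.2 = s • fderiv ℝ (swirl (V w.1)) w.2 := by
    intro O hV w hw
    rw [fderiv_const_add, fderiv_const_mul ((hV.contDiffAt_swirl hw).differentiableAt (by simp))]
  refine ⟨?_, ?_, ?_, ?_⟩
  · refine continuousOn_of_forall_continuousAt fun z hz => ?_
    obtain ⟨O, hzO, -, hV⟩ := key z hz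
    have hc : ContinuousOn (fun w : ℝ × EuclideanSpace ℝ (Fin 3) => c + s * swirl (V w.1) w.2)
        (O : Set (ℝ × EuclideanSpace ℝ (Fin 3))) :=
      continuousOn_const.add (continuousOn_const.mul hV.continuousOn_swirl)
    exact hc.continuousAt (O.isOpen.mem_nhds hzO)
  · intro z hz hzA
    obtain ⟨O, hzO, -, hV⟩ := key z ⟨hz, hzA⟩
    exact contDiffAt_const.add (contDiffAt_const.mul (hV.contDiffAt_swirl hzO))
  · refine continuousOn_of_forall_continuousAt fun z hz => ?_
    obtain ⟨O, hzO, -, hV⟩ := key z hz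
    have hF : ContinuousOn (fun w : ℝ × EuclideanSpace ℝ (Fin 3) => s • fderiv ℝ (swirl (V w.1)) w.2)
        (O : Set (ℝ × EuclideanSpace ℝ (Fin 3))) :=
      (continuousOn_clm_apply.2 fun e => hV.continuousOn_fderiv_swirl_apply e).const_smul s
    exact (hF.congr fun w hw => hgrad hV w hw).continuousAt (O.isOpen.mem_nhds hzO)
  · intro e
    refine continuousOn_of_forall_continuousAt fun z hz => ?_
    obtain ⟨O, hzO, -, hV⟩ := key z hz
    have hG : ContinuousOn (fun w : ℝ × EuclideanSpace ℝ (Fin 3) =>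
        s * fderiv ℝ (fun y => fderiv ℝ (swirl (V w.1)) y e) w.2 e)
        (O : Set (ℝ × EuclideanSpace ℝ (Fin 3))) :=
      continuousOn_const.mul (hV.continuousOn_fderiv_fderiv_swirl_apply e)
    have heq : EqOn (fun w : ℝ × EuclideanSpace ℝ (Fin 3) =>
          fderiv ℝ (fun y => fderiv ℝ (fun y => c + s * swirl (V w.1) y) y e) w.2 e)
        (fun w => s * fderiv ℝ (fun y => fderiv ℝ (swirl (V w.1)) y e) w.2 e)
        (O : Set (ℝ × EuclideanSpace ℝ (Fin 3))) := by
      intro w hw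
      have hloc : (fun y => fderiv ℝ (fun y => c + s * swirl (V w.1) y) y e) =ᶠ[𝓝 w.2]
          fun y => s * fderiv ℝ (swirl (V w.1)) y e := by
        filter_upwards [eventually_mem_slice O.isOpen hw] with y hy
        rw [hgrad hV (w.1, y) hy]
        rfl
      simp only
      rw [hloc.fderiv_eq, fderiv_const_mul (hV.differentiableAt_fderiv_swirl_apply e hw)]
      rfl
    exact (hG.congr heq).continuousAt (O.isOpen.mem_nhds hzO)

/-- **Off the axis, `Π = c + s Γ` has the classical time derivative `s (ΔΓ - DΓ[V] - (2/ϱ)∂_ϱΓ)`,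
continuous in space–time, and solves (2.11): `∂ₜΠ + (V + 2x'/|x'|²)·∇Π - ΔΠ = 0` at every point of
`{t < 0} × {x' ≠ 0}`** (the clause (ii) of the class 𝒱 and the hypothesis (2.12) of Lemma 2.2 —
with equality — for `Π`). [cite: Seregin2020, proof of Thm 2.1, (2.11)–(2.12)] -/
theorem affSwirl_classV_time :
    ∀ (V : ℝ → EuclideanSpace ℝ (Fin 3) → EuclideanSpace ℝ (Fin 3))
      (P : ℝ → EuclideanSpace ℝ (Fin 3) → ℝ) (A : Set (ℝ × EuclideanSpace ℝ (Fin 3))),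
      (∀ z ∈ A, cylRadius z.2 = 0) →
      (∀ a : ℝ, 0 < a → ∀ O : TopologicalSpace.Opens (ℝ × EuclideanSpace ℝ (Fin 3)),
        (O : Set (ℝ × EuclideanSpace ℝ (Fin 3))) ⊆
          parabolicCylinder a (0 : ℝ × EuclideanSpace ℝ (Fin 3)) \ A →
        (∀ θ : ℝ, ∀ z ∈ (O : Set (ℝ × EuclideanSpace ℝ (Fin 3))),
          ((z.1, rotZ θ z.2) : ℝ × EuclideanSpace ℝ (Fin 3)) ∈
            (O : Set (ℝ × EuclideanSpace ℝ (Fin 3)))) →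
        SereginZajaczkowski2007.IsSmoothAxisymmetricSolutionOn O V P) →
      ∀ (c s : ℝ),
    (∀ z : ℝ × EuclideanSpace ℝ (Fin 3), z.1 < 0 → cylRadius z.2 ≠ 0 →
        HasDerivAt (fun r => c + s * swirl (V r) z.2)
          (s * ((Laplacian.laplacian (swirl (V z.1))) z.2 - fderiv ℝ (swirl (V z.1)) z.2 (V z.1 z.2) -
            2 / cylRadius z.2 * partialDeriv (eR z.2) (swirl (V z.1)) z.2)) z.1) ∧
      (∀ z : ℝ × EuclideanSpace ℝ (Fin 3), z.1 < 0 → cylRadius z.2 ≠ 0 →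
        DifferentiableAt ℝ (fun r => c + s * swirl (V r) z.2) z.1) ∧
      ContinuousOn (fun z : ℝ × EuclideanSpace ℝ (Fin 3) =>
          deriv (fun r => c + s * swirl (V r) z.2) z.1)
        {z | z.1 < 0 ∧ cylRadius z.2 ≠ 0} ∧
      ∀ z : ℝ × EuclideanSpace ℝ (Fin 3), z.1 < 0 → cylRadius z.2 ≠ 0 →
        deriv (fun r => c + s * swirl (V r) z.2) z.1 +
            fderiv ℝ (fun y => c + s * swirl (V z.1) y) z.2 (V z.1 z.2) +
            2 / cylRadius z.2 * partialDeriv (eR z.2) (fun y => c + s * swirl (V z.1) y) z.2 -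
          (Laplacian.laplacian (fun y => c + s * swirl (V z.1) y)) z.2 = 0 := by
  intro V P A haxis hVcl c s
  have hD : ∀ z : ℝ × EuclideanSpace ℝ (Fin 3), z.1 < 0 → cylRadius z.2 ≠ 0 →
      HasDerivAt (fun r => c + s * swirl (V r) z.2)
        (s * ((Δ (swirl (V z.1))) z.2 - fderiv ℝ (swirl (V z.1)) z.2 (V z.1 z.2) -
          2 / cylRadius z.2 * partialDeriv (eR z.2) (swirl (V z.1)) z.2)) z.1 :=
    fun z hz hρ => ((hasDerivAt_swirl_repr haxis hVcl hz hρ).const_mul s).const_add c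
  refine ⟨hD, fun z hz hρ => (hD z hz hρ).differentiableAt, ?_, fun z hz hρ => ?_⟩
  · exact (continuousOn_const.mul (continuousOn_swirlOperator_repr haxis hVcl)).congr
      fun z hz => (hD z hz.1 hz.2).deriv
  · -- the class near the off-axis point
    have hapos : (0 : ℝ) < (⌈‖z.2‖ + |z.1|⌉₊ : ℝ) + 1 := by positivity
    have hzO := mem_offAxisRegion_natCeil hz hρ
    have hV := isSmoothAxisymmetricSolutionOn_offAxisRegion haxis hVcl hapos
    have hsm : ContDiffAt ℝ (⊤ : ℕ∞) (swirl (V z.1)) z.2 := hV.contDiffAt_swirl hzO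
    have hgrad : fderiv ℝ (fun y => c + s * swirl (V z.1) y) z.2 = s • fderiv ℝ (swirl (V z.1)) z.2 := by
      rw [fderiv_const_add, fderiv_const_mul (hsm.differentiableAt (by simp))]
    have hlap : (Δ (fun y => c + s * swirl (V z.1) y)) z.2 = s * (Δ (swirl (V z.1))) z.2 := by
      have e : (fun y => c + s * swirl (V z.1) y) =
          (fun _ => c) + s • swirl (V z.1) := by
        funext y
        simp [smul_eq_mul]
      have h2 : ContDiffAt ℝ 2 (swirl (V z.1)) z.2 := hsm.of_le (by norm_cast)
      have h2s : ContDiffAt ℝ 2 (s • swirl (V z.1)) z.2 := h2.const_smul s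
      rw [e, contDiffAt_const.laplacian_add h2s, InnerProductSpace.laplacian_smul s h2]
      simp [smul_eq_mul]
    rw [(hD z hz hρ).deriv, hgrad, partialDeriv_apply, partialDeriv_apply, hgrad, hlap]
    simp only [smul_apply, smul_eq_mul]
    ring

end Class

end Summit.NavierStokesRegularity.NavierStokesRegularity.Theorems.AxisymmetricKatoGlobal.EulerScaling

end
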